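import Summits.BirchSwinnertonDyer.BirchSwinnertonDyer.Theorems.SignedLowerHalvesSmallImageLowerHalfBothSignsRttRecipMTHeckeL
import Literature.NumberTheory.EllipticCurves.CyclotomicCharactersOfGammaProofs
import HarnessLib

/-!
# S4″ θ-side in `hval` currency: `Ω′ · e(θ_{n+1}(g;Ω)^ι(ζ − 1)) = τ(χ_ζ) · Λ_{χ_ζ}(1)` for EVERY primitive `p^{n+1}`-th root `ζ ∈ ℚ̄_p`

Summit `BirchSwinnertonDyer`, crux `SmallImageLowerHalfBothSigns` (stmt-23599), line `rtt_w3`, stub `stub_junctionRecipMT_ns` (S4″), «recip-an» half.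
Namespace `…Theorems.SmallImageRttReciprocity`. THEOREMS ONLY.

The LEAD's closing theorem `isCongrModOmegaO_of_primitive_values` (file `…RttRecipMTOfValues`) consumes the hypothesis
`hval : ∃ n₀, ∀ n ≥ n₀, (Even n ↔ ε = 1) → ∀ ζ, IsPrimitiveRoot ζ (p^n) → d·u_n(ζ−1)·θ_n(ζ−1) = (−1)^{n/2+1}·c·Σ_i ev_{n,i} ζ^{p^n−i}` — values of the
`ι`-mapped Mazur–Tate elements at `ζ − 1` for the primitive `p^n`-th roots of unity `ζ` of `ℚ̄_p`. This file puts the θ-SIDE in exactly that currency: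
composing `exists_period_transport` (p824895: complex conjugate newform `g'`, period `Ω′`, the values at the even primitive `p`-power-order `χ`),
`exists_dirichletCharacter_apply_cyclotomicGenerator_eq` (every primitive `p^{n+1}`-th root `e(ζ) ∈ ℂ` is `χ(γ)` for such a `χ` of conductor
`p^{n+1+e₀}`) and `twistedLSeries_conj_eq_rayClassLSeries` (p825887: `L(g' ⊗ χ⁻¹, s) = L_K(𝔣', ψ'_χ, s)`, θ-currency), we get ONE package:

  `∃ g' Ω', newform ∧ Ω' ≠ 0 ∧ a_n(g') = e(ι(a_n(g))) ∧ ⟨r⟩⁺_{g'} = Ω'·e(ι[r]⁺_{g,Ω}) ∧ (L(g',1) clause) ∧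
     ∀ n ζ, IsPrimitiveRoot ζ (p^{n+1}) → ∃ χ (primitive, even, p-power order, χ(γ) = e ζ),
       (∃ σ₀ ≥ 2, L(g' ⊗ χ⁻¹, s) = rayClassLSeries 𝔣' ψ'_χ s on re s > σ₀) ∧
       ∀ Λ entire agreeing with rayClassLSeries 𝔣' ψ'_χ on a right half-plane, Ω' · e((θ_{n+1}(g;Ω)).eval₂ ι (ζ − 1)) = τ(χ)·Λ(1)`,

`ψ'_χ(w) = e(θ(Frob_w)₀₀)·χ⁻¹(N w)`. Print input: `hBad` only (Euler factors of the CM newform at the primes of `|d_K|·N𝔪`).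

* `exists_period_transport_rayClass` — the package above.

References: [MazurTateTeitelbaum1986Invent] §I.8, §I.13; [Ribet1977Nebentypus] §3; [Shimura1977] Thm. 1; [DiamondShurman2005] Thm. 6.5.4.
-/

-- the Theorems namespace of this sub repeats the summit name by design (D-0017 nested layout)
set_option linter.dupNamespace false

noncomputable section

open scoped Classical MatrixGroups ModularForm NumberField
open Polynomial CongruenceSubgroup NumberField IsDedekindDomain
  Literature.NumberTheory.GaloisRepresentations Literature.NumberTheory.LFunctions Literature.NumberTheory.Automorphic
  Literature.NumberTheory.EllipticCurves Literature.NumberTheory.EllipticCurves.ModularForms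

namespace Summit.BirchSwinnertonDyer.BirchSwinnertonDyer.Theorems.SmallImageRttReciprocity

variable {p : ℕ} [Fact p.Prime]

/-- ★★ **The θ-side of S4″ in `hval` currency.** For the S4″ frame data (`K, ψ, g, ι, θ` pinned to `ψ` off `p𝔪`), the print input `hBad`, any
Frobenius choice `φ`, any `𝔣' ≠ 0` supported on the places over `p` and the `θ`-ramified places, and a plus period `Ω` of `g`: the complex conjugate
newform `g'` and the transported period `Ω′` of `exists_period_transport`, together with, for every primitive `p^{n+1}`-th root of unity `ζ ∈ ℚ̄_p`, the
even primitive `p`-power-order character `χ` of conductor `p^{n+1+e₀}` with `χ(γ) = e(ζ)`, the Dirichlet-series identity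
`L(g' ⊗ χ⁻¹, s) = rayClassLSeries 𝔣' ψ'_χ s` (`re s > σ₀`), and the value formula `Ω′ · e(θ_{n+1}(g;Ω).eval₂ ι (ζ − 1)) = τ(χ) · Λ(1)` for every
entire `Λ` continuing `s ↦ rayClassLSeries 𝔣' ψ'_χ s`. [cite: MazurTateTeitelbaum1986Invent, §I.8 (8.6) and §I.13] [cite: Ribet1977Nebentypus, §3 Cor. (3.5)]
[cite: Shimura1977, Thm. 1] [cite: DiamondShurman2005, Thm. 6.5.4] -/
theorem exists_period_transport_rayClass (K : Type) [Field K] [NumberField K] (hK2 : Module.finrank ℚ K = 2) (htc : IsTotallyComplex K)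
    (σK : K →+* ℂ) (𝔪 : Ideal (𝓞 K)) (h𝔪 : 𝔪 ≠ ⊥) (ψ : HeightOneSpectrum (𝓞 K) → ℂ) (hψ : IsGrossencharakter 𝔪 (embType σK) (embTypeConj σK) ψ)
    (hψpow : ∀ n : ℕ, Odd n → n.Coprime ((discr K).natAbs * Ideal.absNorm 𝔪) →
      idealPow K ψ (Ideal.span {(n : 𝓞 K)}) = (jacobiSym (discr K) n : ℂ) * (n : ℂ) ^ (2 - 1))
    (e : PadicAlgCl p ≃+* ℂ) {M : ℕ} [NeZero M] (g : CuspForm (Gamma0 M) 2) (ι : coeffField g →+* PadicAlgCl p) (hng : IsNewform0 g)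
    (hcoeffψ : ∀ ℓ : ℕ, ℓ.Prime → ¬ ℓ ∣ (discr K).natAbs * Ideal.absNorm 𝔪 →
      embCoeff g ι ℓ = e.symm (∑ᶠ (w : HeightOneSpectrum (𝓞 K)) (_ : Ideal.absNorm w.asIdeal = ℓ), ψ w))
    (S : Set (PadicAlgCl p)) (θ : FramedGaloisRep K (padicCoeffIntegers S) 1)
    (hθ : ∀ w : HeightOneSpectrum (𝓞 K), ((p : ℕ) : 𝓞 K) ∉ w.asIdeal → ¬ 𝔪 ≤ w.asIdeal →
      θ.IsUnramifiedAt w ∧ ∃ P : Polynomial (padicCoeffIntegers S), P.map (padicCoeffIntegers S).subtype = X - C (e.symm (ψ w)) ∧ θ.HasFrobCharpolyAt w P)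
    (hBad : Ribet1977_cmNewform_gamma0_badEulerFactor_padicCharacter)
    (φ : HeightOneSpectrum (𝓞 K) → Field.absoluteGaloisGroup K) (hφ : ∀ w : HeightOneSpectrum (𝓞 K), ∃ 𝔓 ∈ w.primesAbove, IsArithFrobAt (𝓞 K) (φ w) 𝔓)
    (𝔣' : Ideal (𝓞 K)) (h𝔣'0 : 𝔣' ≠ ⊥)
    (h𝔣' : ∀ w : HeightOneSpectrum (𝓞 K), 𝔣' ≤ w.asIdeal ↔ (((p : ℕ) : 𝓞 K) ∈ w.asIdeal ∨ ¬ θ.IsUnramifiedAt w))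
    (Ω : ℂ) (hΩ : IsPlusPeriod g Ω) :
    ∃ (g' : CuspForm (Gamma0 M) 2) (Ω' : ℂ), IsNewform0 g' ∧ Ω' ≠ 0 ∧
      (∀ n : ℕ, cuspCoeff g' n = e (ι ⟨cuspCoeff g n, coeff_mem_coeffField g n⟩)) ∧
      (∀ r : ℚ, plusSymbol g' r = Ω' * e (ι (plusSymbolK g Ω r))) ∧
      (∀ {L : ℂ → ℂ}, Differentiable ℂ L → (∀ s : ℂ, 2 < s.re → L s = cuspFormLSeries g' s) → Ω' * e (ι (plusSymbolK g Ω 0)) = L 1) ∧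
      ∀ (n : ℕ) (ζ : PadicAlgCl p), IsPrimitiveRoot ζ (p ^ (n + 1)) →
        ∃ χ : DirichletCharacter ℂ (p ^ (n + 1 + cyclotomicExponent p)), χ.IsPrimitive ∧ χ.Even ∧ (∃ i : ℕ, orderOf χ = p ^ i) ∧
          χ (cyclotomicGenerator p : ZMod (p ^ (n + 1 + cyclotomicExponent p))) = e ζ ∧
          (∃ σ₀ : ℝ, 2 ≤ σ₀ ∧ ∀ s : ℂ, σ₀ < s.re → twistedLSeries g' χ⁻¹ s =
            rayClassLSeries 𝔣' (fun w : HeightOneSpectrum (𝓞 K) ↦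
              e ((((θ (φ w) : GL (Fin 1) (padicCoeffIntegers S)) : Matrix (Fin 1) (Fin 1) (padicCoeffIntegers S)) 0 0 : padicCoeffIntegers S) :
                PadicAlgCl p) * χ⁻¹ ((Ideal.absNorm w.asIdeal : ℕ) : ZMod (p ^ (n + 1 + cyclotomicExponent p)))) s) ∧
          ∀ {Λ : ℂ → ℂ}, Differentiable ℂ Λ →
            (∃ σ₁ : ℝ, ∀ s : ℂ, σ₁ < s.re → Λ s =
              rayClassLSeries 𝔣' (fun w : HeightOneSpectrum (𝓞 K) ↦
                e ((((θ (φ w) : GL (Fin 1) (padicCoeffIntegers S)) : Matrix (Fin 1) (Fin 1) (padicCoeffIntegers S)) 0 0 : padicCoeffIntegers S) :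
                  PadicAlgCl p) * χ⁻¹ ((Ideal.absNorm w.asIdeal : ℕ) : ZMod (p ^ (n + 1 + cyclotomicExponent p)))) s) →
            Ω' * e ((mazurTateElementK g Ω p (n + 1)).eval₂ ι (ζ - 1)) =
              gaussSum χ (ZMod.stdAddChar (N := p ^ (n + 1 + cyclotomicExponent p))) * Λ 1 := by
  obtain ⟨g', Ω', hg', hΩ', hconj, hplus, hvals, hval0⟩ := exists_period_transport g ι Ω e hng hΩ
  refine ⟨g', Ω', hg', hΩ', hconj, hplus, hval0, fun n ζ hζ ↦ ?_⟩
  obtain ⟨χ, hprim, heven, hord, hχγ⟩ :=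
    exists_dirichletCharacter_apply_cyclotomicGenerator_eq (F := ℂ) n (hζ.map_of_injective (f := e) e.injective)
  have hm : p ∣ p ^ (n + 1 + cyclotomicExponent p) := dvd_pow_self p (by omega)
  have hident := twistedLSeries_conj_eq_rayClassLSeries K hK2 htc σK 𝔪 h𝔪 ψ hψ hψpow e g ι hng hcoeffψ S θ hθ hBad g' hg' hconj φ hφ 𝔣' h𝔣'0 h𝔣' χ hm
    (fun w : HeightOneSpectrum (𝓞 K) ↦
      e ((((θ (φ w) : GL (Fin 1) (padicCoeffIntegers S)) : Matrix (Fin 1) (Fin 1) (padicCoeffIntegers S)) 0 0 : padicCoeffIntegers S) : PadicAlgCl p) *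
        χ⁻¹ ((Ideal.absNorm w.asIdeal : ℕ) : ZMod (p ^ (n + 1 + cyclotomicExponent p)))) (fun _ _ ↦ rfl)
  refine ⟨χ, hprim, heven, hord, hχγ, hident, fun {Λ} hΛ hΛR ↦ ?_⟩
  have hT : e ((mazurTateElementK g Ω p (n + 1)).eval₂ ι (ζ - 1)) =
      (mazurTateElementK g Ω p (n + 1)).eval₂ ((e : PadicAlgCl p →+* ℂ).comp ι)
        (χ (cyclotomicGenerator p : ZMod (p ^ (n + 1 + cyclotomicExponent p))) - 1) := by
    rw [hχγ, ← RingEquiv.coe_toRingHom, Polynomial.hom_eval₂, map_sub, map_one]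
  rw [hT]
  exact recipMT_eq_gaussSum_mul_of_rayClassLSeries χ (fun hL hLs ↦ hvals χ heven hord hprim hL hLs) hident hΛ hΛR

end Summit.BirchSwinnertonDyer.BirchSwinnertonDyer.Theorems.SmallImageRttReciprocity

end
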